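import Literature.AlgebraicGeometry.ModuliOfAbelianVarieties.SiegelShimuraSetPrincipalDissectionTower
import Literature.AlgebraicGeometry.ModuliOfAbelianVarieties.SiegelShimuraSetTransitionDegree
import HarnessLib

/-!
# The principal dissection at the granularity of the Siegel levels `K : SiegelLevel δ` (the binders of ★ (σ3) `SiegelComplexRecordSystem`)

Topic `AlgebraicGeometry/ModuliOfAbelianVarieties`; namespace `Literature.AlgebraicGeometry.ModuliOfAbelianVarieties`.
THEOREMS ONLY (no definition, no named fact, no instance, no `sorry`).  Cell hodgecm-mathlib (D-0151), #60 road leaf R60-27c: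
★ R60-27 `SiegelModuliDatum.exists_sigma_equiv_siegelShimuraSet` and ★ R60-27b `SiegelShimuraSet.restrict_mk_diag_eq_mk_diag` /
`restrict_sigma_equiv_apply` RESTATED over the exact binders of the hypothesis structure ★ (σ3) `SiegelComplexRecordSystem`:
a Siegel LEVEL `K : SiegelLevel δ` (so `K.1 = K_δ(K.N)`, `3 ≤ K.N`, ★ `SiegelLevel.val_eq` / `three_le_N`) instead of an integer
`N ≥ 3`, and an ARROW `f : K ⟶ K′` of the level poset (so `K′.N ∣ K.N`, ★ R60-41 `SiegelLevel.N_dvd_N_of_hom`) instead of a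
divisibility — the shapes of the fields `pts K : Mc_K(ℂ) ≃ SiegelShimuraSet δ K.1`, `Q K`, `rep K q`, `incl_unif`, `map_pts`.
[Milne2005ShimuraVarieties] Lemma 5.13 p. 57, Thm. 5.17 p. 59; [Deligne1971TravauxShimura] 1.8 p. 129, 4.16 p. 150.
HC_CM is proved only modulo the 7 printed citations until rung 0 closes; this file proves no cell binder (books 0).

## References
* [Milne2005ShimuraVarieties] J. S. Milne, *Introduction to Shimura varieties* (2005), §5 Lemma 5.13 p. 57, Thm. 5.17 p. 59; §6 p. 70.
* [Deligne1971TravauxShimura] P. Deligne, *Travaux de Shimura* (1971), 1.8 p. 129, Exemple 4.16 p. 150.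
-/

set_option autoImplicit false

noncomputable section

open Matrix NumberField IsDedekindDomain CategoryTheory

namespace Literature.AlgebraicGeometry.ModuliOfAbelianVarieties

open Literature.AlgebraicGeometry.Motives (ComplexPoints)
open Literature.NumberTheory.Automorphic (siegelUpperHalfSpace)
open SiegelModuli

variable {g : ℕ} {δ : Fin g → ℕ}

/-- **The principal dissection at a Siegel level `K`** (★ R60-27 read through `K.1 = K_δ(K.N)`): for every Siegel fine moduli datum
`D` of type `δ` and level `K.N` there are `ẑ`-units `u_c` of residue `c ∈ (ℤ/K.N)^×`, integral diagonal representatives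
`rep c = diag(1_g, u_c·1_g) ∈ K_δ(1)` and a bijection `e : (Σ c, D.S(ℂ)) ≃ SiegelShimuraSet δ K.1` with
`e ⟨c, D.unif Z⟩ = [J(Z), (rep c)·K.1]` — the one-level content of the fields `Q K := (ZMod K.N)ˣ`, `rep K`, `pts K`, `incl_unif`
of ★ (σ3) for `Mc_K := ∐_c D.S`. [cite: Milne2005ShimuraVarieties, Lemma 5.13 p. 57 and Thm. 5.17 p. 59] [cite: Deligne1971TravauxShimura, Exemple 4.16 p. 150] -/
theorem SiegelModuliDatum.exists_sigma_equiv_siegelShimuraSet_level (hδ : IsPolarizationType δ) (hg : 0 < g) (K : SiegelLevel δ)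
    (D : SiegelModuliDatum g δ K.N) :
    ∃ (u : (ZMod K.N)ˣ → finAdeleQˣ) (rep : (ZMod K.N)ˣ → gspFinAdelic δ)
      (e : (Σ _ : (ZMod K.N)ˣ, ComplexPoints D.S) ≃ SiegelShimuraSet δ K.1),
      (∀ c, (∀ v, Valued.v ((u c : finAdeleQ) v) = 1) ∧ (u c : finAdeleQ) - ((c : ZMod K.N).val : ℕ) ∈ levelIdeal K.N ∧
        rep c ∈ principalLevelSubgroup δ 1 ∧
          IsMultiplier (typeFormOver δ finAdeleQ) (rep c : GL (Fin g ⊕ Fin g) finAdeleQ) (u c) ∧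
            ((rep c : GL (Fin g ⊕ Fin g) finAdeleQ) : Matrix (Fin g ⊕ Fin g) (Fin g ⊕ Fin g) finAdeleQ) =
              Matrix.fromBlocks 1 0 0 ((u c : finAdeleQ) • (1 : Matrix (Fin g) (Fin g) finAdeleQ))) ∧
      ∀ (c : (ZMod K.N)ˣ) (Z : siegelUpperHalfSpace g),
        e ⟨c, D.unif Z⟩ = SiegelShimuraSet.mk δ K.1 ⟨jOfSiegel δ Z, jOfSiegel_coe_mem_C0pm hδ.1 Z⟩ (rep c) := by
  rw [K.val_eq]
  exact SiegelModuliDatum.exists_sigma_equiv_siegelShimuraSet hδ hg K.three_le_N D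

/-- **The transition along an arrow of Siegel levels on representatives** (★ R60-27b read through `SiegelLevel.le_of_hom` and
★ `SiegelLevel.N_dvd_N_of_hom`): for `f : K ⟶ K′` (so `K.1 ≤ K′.1`, `K′.N ∣ K.N`) and residue-respecting integral-diagonal
representative families at the two levels, `restrict [J, rep c·K.1] = [J, rep′ (unitsMap c)·K′.1]` — the set-level `map_pts`.
[cite: Deligne1971TravauxShimura, 1.8 p. 129] [cite: Milne2005ShimuraVarieties, Thm. 5.17 p. 59] -/
theorem SiegelShimuraSet.restrict_mk_diag_eq_mk_diag_level (hg : 0 < g) {K K' : SiegelLevel δ} (f : K ⟶ K')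
    {u : (ZMod K.N)ˣ → finAdeleQˣ} {rep : (ZMod K.N)ˣ → gspFinAdelic δ}
    {u' : (ZMod K'.N)ˣ → finAdeleQˣ} {rep' : (ZMod K'.N)ˣ → gspFinAdelic δ}
    (hu : ∀ c v, Valued.v ((u c : finAdeleQ) v) = 1) (hua : ∀ c, (u c : finAdeleQ) - ((c : ZMod K.N).val : ℕ) ∈ levelIdeal K.N)
    (hrep : ∀ c, ((rep c : GL (Fin g ⊕ Fin g) finAdeleQ) : Matrix (Fin g ⊕ Fin g) (Fin g ⊕ Fin g) finAdeleQ) =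
      Matrix.fromBlocks 1 0 0 ((u c : finAdeleQ) • (1 : Matrix (Fin g) (Fin g) finAdeleQ)))
    (hu' : ∀ c v, Valued.v ((u' c : finAdeleQ) v) = 1) (hua' : ∀ c, (u' c : finAdeleQ) - ((c : ZMod K'.N).val : ℕ) ∈ levelIdeal K'.N)
    (hrep' : ∀ c, ((rep' c : GL (Fin g ⊕ Fin g) finAdeleQ) : Matrix (Fin g ⊕ Fin g) (Fin g ⊕ Fin g) finAdeleQ) =
      Matrix.fromBlocks 1 0 0 ((u' c : finAdeleQ) • (1 : Matrix (Fin g) (Fin g) finAdeleQ)))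
    (J : C0pm δ) (c : (ZMod K.N)ˣ) :
    SiegelShimuraSet.restrict δ (SiegelLevel.le_of_hom f) (SiegelShimuraSet.mk δ K.1 J (rep c)) =
      SiegelShimuraSet.mk δ K'.1 J (rep' (ZMod.unitsMap (SiegelLevel.N_dvd_N_of_hom hg f) c)) := by
  haveI : NeZero K.N := ⟨by have := K.three_le_N; omega⟩
  have hN' : K'.N ≠ 0 := by have := K'.three_le_N; omega
  rw [SiegelShimuraSet.restrict_mk, K'.val_eq]
  exact SiegelShimuraSet.mk_eq_mk_of_coe_eq_fromBlocks J (hrep' _) (hrep c) (hu' _) (hu c)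
    (SiegelShimuraSet.sub_mem_levelIdeal_of_residues hN' (SiegelLevel.N_dvd_N_of_hom hg f) (hua c) (hua' _))

end Literature.AlgebraicGeometry.ModuliOfAbelianVarieties

end
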